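import Mathlib

/-!
# Bałaban [B5] CMP 95 (1984), Sect. E pp. 33–35: the identities (1.95) `R∂*GQ* = 0, QG∂R = 0`,
# (1.97) `R∂*G∂ = ∂*G∂R = R`, the consequence (1.98), and the projection (1.106)/(1.107)
# `P = I − G∂R∂* − GQ*(QGQ*)⁻¹Q` — the printed operator algebra, kernel-checked abstractly

statement-level skeleton of published theorems with citation tags; proofs where landed; nothing here is a claim about the Yang–Mills mass gap

v1.1 (DOCFIX for ref-3's cite lint, 2026-08-20): framing sentence on one line; the private helper's docstring names
its role; no declaration changed.

CITATION HEADER (lean-in-tree rule).  T. Bałaban, *Propagators and renormalization transformations for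
lattice gauge theories. I*, Commun. Math. Phys. **95** (1984) 17–40 [`Balaban1984PropagatorsI`] (= B5 of the
series `Balaban1983to89`; journal page = PDF page + 16).  Pages read for this module AS IMAGES: renders
`run/shared/lean/pub/pub-balaban/b2b-balaban-ref1/pages/1984-cmp95-propagators-rt-I/1984-cmp95-propagators-rt-I-p017-x2.png`
(p. 33), `…-p018-x2.png` (p. 34); p. 35 from the OCR text `paper:balaban1984-cmp95-propagators-rt-i` p0019.
Cell `lit-balaban` (mega-formalization, Phase 1), unit `lit-balaban-r02` (reader/typer of B5), SKELETON rows
B5-55 … B5-60 of `run/shared/lean/pub/lit-balaban/lit-balaban-r02/SKELETON-B5.md`.  Before this module no tree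
file mentioned (1.96)/(1.97), and (1.104)–(1.107) existed only as the scalar `ℤ^d` shadow `B5Proj107L2Zd`
(which has no gauge term `−G∂R∂*`).

WHAT IS PRINTED (verbatim).  p. 33 [PDF 17], after Proposition 1.1: «Let us now come back to the integral (1.68)
and to a calculation of H_kB. It is defined as a minimum of the form ½⟨A, Δ_aA⟩ − a⟨B, B⟩ under the conditions
QA = B, R∂*A = 0. We introduce the function
  h(A, ω, λ) = ½⟨A, Δ_aA⟩ + ⟨ω, QA−B⟩ + ⟨λ, R∂*A⟩, Rλ = λ,   (1.91)
ω and λ are Lagrange multipliers, and we solve the equations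
  δh/δA = Δ_aA + Q*ω + ∂λ = 0,  δh/δω = QA − B = 0,  δh/δλ = R∂*A = 0.   (1.92)
We get
  A = −GQ*ω − G∂λ,  R∂*A = −R∂*GQ*ω − R∂*G∂λ = 0.   (1.93)
Let us calculate the operators R∂*GQ* and R∂*G∂.» … «The operator R is given by the formula
R = I − P = I − Δ⁻¹Q′*·(Q′Δ⁻²Q′*)⁻¹Q′Δ⁻¹, so RΔ⁻¹Q′* = 0 and we have
  R∂*GQ* = 0, QG∂R = 0.   (1.95)
Calculating ∂*G∂ we get the formula
  ∂*G∂ = I + Δ⁻¹Q′*[(Q′Δ⁻²Q′*)⁻¹a⁻¹(∂₁*φ⁻¹∂₁)⁻¹(Q′Δ⁻²Q′*)⁻¹ − 2(Q′Δ⁻²Q′*)⁻¹]Q′Δ⁻¹,   (1.96)»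
p. 34 [PDF 18]: «and from this it follows that
  R∂*G∂ = ∂*G∂R = R.   (1.97)
The equalities (1.95), (1.97) imply that the second equation in (1.93) has the form Rλ = λ = 0. Thus we have
  A = −GQ*ω,   (1.98)
and the condition R∂*A = 0 is satisfied automatically.» … «so finally we get the representation
  H_kB = GQ*(QGQ*)⁻¹B.   (1.103)
This representation allows us to reduce a proof of properties of H_k to the corresponding properties of G.
  In a similar way we can construct another important operator with the help of G, namely an orthogonal
projection in the metric ⟨A, Δ_aA⟩ on the subspace of A satisfying the conditions QA = 0, R∂*A = 0. This
projection can be found as a minimum of the form ⟨A − A₀, Δ_a(A − A₀)⟩ on the subspace of A₀ satisfying the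
conditions QA₀ = 0, R∂*A₀ = 0. We consider the function
  g(A₀, ω, λ) = ½⟨A₀ − A, Δ_a(A₀ − A)⟩ + ⟨ω, QA₀⟩ + ⟨λ, R∂*A₀⟩, Rλ = λ,   (1.104)
and the equations
  δg/δA₀ = Δ_aA₀ − Δ_aA + Q*ω + ∂λ = 0,  δg/δω = QA₀ = 0,  δg/δλ = R∂*A₀ = 0.   (1.105)»
p. 35 [PDF 19]: «The first equation gives A₀ = A − GQ*ω − G∂λ, and R∂*A₀ = R∂*A − R∂*GQ*ω − R∂*G∂λ = R∂*A − λ = 0,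
so A₀ = A − G∂R∂*A − GQ*ω. The second equation gives QA₀ = QA − QG∂R∂*A − QGQ*ω = QA − QGQ*ω = 0, so we get the
following formula for the projection
  A₀ = PA = A − G∂R∂*A − GQ*(QGQ*)⁻¹QA   (1.106)
or
  P = I − G∂R∂* − GQ*(QGQ*)⁻¹Q.   (1.107)»
The structural inputs used by this derivation are printed earlier: (1.69) p. 29 «Δ_a = ∂*∂ + ∂R∂* + aQ*Q =
Δ − ∂P∂* + aQ*Q, Δ = ∂*∂ + ∂∂*, R = I − P»; (1.55) p. 27 «Q_k∂ = ∂₁Q′_k, ∂₁ is the unit lattice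
differentiation»; (1.21) p. 21 (Δ the η-lattice Laplacian for scalar functions, ∂* the divergence); p. 25
[PDF 9] «The projection operator R has a clear meaning. It is an orthogonal projection on the linear subspace
ΔN(Q′_k) of L²(T_η), N(Q′_k) = {λ : Q′_kλ = 0}. Indeed RΔλ = Δλ if Q′_kλ = 0, and if Rω = ω then … ω = Δλ and
Q′_kλ = 0.»; (1.71) p. 30 «Δ_a⁻¹ = G_k, or simply G»; Prop. 1.1 p. 33 «The operator G is a symmetric operator».

WHAT THIS MODULE PROVES (KERNEL, over abstract finite index types and complex matrices — the currency of the
tree's torus operators `B5DeltaA169.DeltaA`, `B5Value126.PcT`, `B5Action121.GradOp`, `B5Block118.QvOp/QsOp`).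
The bundle `Ops` names the operators (∂ = `D`, ∂* = `Ds`, scalar Δ = `Lap`, the curl part `K` = ∂*∂ of (1.69)
on vector fields, `R`, `Q` = Q_k, `Qs` = Q_k*, `Q'` = Q′_k, `D₁` = ∂₁, `a`, `Da` = Δ_a, `G`); the `Prop`-valued
`Ops.Laws` lists EXACTLY the printed structural facts quoted above ((1.69) with ∂(∂λ) = 0 i.e. `K * D = 0`,
Δ = ∂*∂ on scalars, (1.55), the two p. 25 sentences on R, G = Δ_a⁻¹ two-sided); `Ops.Adj` adds the adjointness
facts used for the left halves (G symmetric = Prop. 1.1, R symmetric = "orthogonal projection", ∂* = ∂ᴴ, Q* = c·Qᴴ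
for the weighted adjoint).  From `Laws`:
* `da_grad` — the MECHANISM the print leaves implicit: Δ_a(∂λ) = ∂(Δλ) for Q′_kλ = 0; `g_grad_r` — G∂Rω = ∂λ
  with Rω = Δλ, Q′_kλ = 0;
* `eq197_right` — **(1.97), right form** `∂*G∂R = R`; `eq195_right` — **(1.95), second identity** `QG∂R = 0`;
  `r_idem` — `R² = R`;
* with `Adj`: `eq197_left` — **(1.97), left form** `R∂*G∂ = R`; `eq195_left` — **(1.95), first identity**
  `R∂*GQ* = 0`; `eq198` — the printed inference «(1.95), (1.97) imply that the second equation in (1.93) has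
  the form Rλ = λ = 0»;
* `proj107` — the operator (1.107) with `E` a right inverse of `QGQ*` ((1.100): invertible), and
  `q_proj107` (QP = 0), `rds_proj107` (R∂*P = 0), `proj107_fix` (P = id on {QA = 0, R∂*A = 0}),
  `proj107_idem` (P² = P), `proj107_orth` (Δ_a-orthogonality ⟨A₀, Δ_a(A − PA)⟩ = 0 for QA₀ = 0, R∂*A₀ = 0 —
  «an orthogonal projection in the metric ⟨A, Δ_aA⟩»), `proj107_solves_105` ((1.106) solves (1.105)).
The bookkeeping (1.95) + (1.103) ⇒ Q_kH_k = I, R∂*H_k = 0 is ALREADY `B5.hk_props` (not restated here).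

HONEST SCOPE.  (i) ABSTRACT operator algebra: nothing here identifies `Ops` with Bałaban's torus operators; the
instantiation `D := GradOp`, `Ds := GradOpᴴ`, `Lap := LapS`, `R := 1 − PcT`, `Q := QvOp`, `Qs := QvAdj`,
`Q' := QsOp`, `D₁ := GradOp (Tor M) 1`, `Da := DeltaA`, `G := DeltaA⁻¹` and the discharge of `Laws`/`Adj` from
`B5DeltaA169.DeltaA_eq_curl`, `B5Hk160Torus.QvOp_GradOp_mulVec` ((1.55)), `B5Projector144Torus` /
`B5GaussSectC` §7 (R = orthogonal projection onto ΔN(Q′_k)), `B5Prop11Lattice.DeltaA_inv_isHermitian` is the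
Phase-2 row of SKELETON B5-57/B5-60 (not done here).  (ii) The explicit formulas (1.94), (1.96) and the
Lagrange systems (1.91)/(1.92), (1.104)/(1.105) are NOT transcribed as Lean terms: the print uses them only to
reach (1.95), (1.97), (1.106), which are proved here from the structural facts directly (a genuinely shorter
road: Δ_a∂λ = ∂Δλ on N(Q′_k)).  (iii) Finite index types, field ℂ (the torus setting of Sect. 1; no infinite
lattice).  Value = typed skeleton rows + kernel discharge of the printed algebra, NOT summit progress.
-/

namespace Literature.MathematicalPhysics.QuantumFieldTheory.Balaban1983to89.B5Identities197

open Matrix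

/-- The operators of B5 Sects. C–E as abstract complex matrices: `S` = scalar functions on T_η, `V` = vector
(bond) functions on T_η, `S₁` = scalar functions on the unit lattice T₁^{(k)}, `W` = vector functions on T₁^{(k)};
`D` = ∂ (gradient, (1.4)), `Ds` = ∂* (divergence, (1.21)), `Lap` = Δ on scalars ((1.21)), `K` = the part ∂*∂ of
(1.69) acting on vector functions (curl†·curl), `R` ((1.38)/(1.44)), `Q` = Q_k ((1.18)), `Qs` = Q_k* , `Q'` = Q′_k
((1.20)), `D₁` = ∂₁ (unit-lattice gradient, (1.55)), `a` > 0 the averaging weight, `Da` = Δ_a ((1.69)),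
`G` = G_k ((1.71)). [cite: Balaban1984PropagatorsI, (1.69) p.29, (1.71) p.30] -/
structure Ops (S V S₁ W : Type*) where
  D : Matrix V S ℂ
  Ds : Matrix S V ℂ
  Lap : Matrix S S ℂ
  K : Matrix V V ℂ
  R : Matrix S S ℂ
  Q : Matrix W V ℂ
  Qs : Matrix V W ℂ
  Q' : Matrix S₁ S ℂ
  D₁ : Matrix W S₁ ℂ
  a : ℂ
  Da : Matrix V V ℂ
  G : Matrix V V ℂ

variable {S V S₁ W : Type*} [Fintype S] [Fintype V] [Fintype S₁] [Fintype W] [DecidableEq V]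

/-- The printed structural facts behind (1.95)/(1.97): (1.69) «Δ_a = ∂*∂ + ∂R∂* + aQ*Q» (`da_eq`) with ∂(∂λ) = 0
(the plaquette variable (1.2) of a pure gauge (1.4) vanishes: `curl_grad`), «Δ = ∂*∂» on scalar functions
((1.21), `div_grad`), (1.55) «Q_k∂ = ∂₁Q′_k» (`q_grad`), p. 25 «RΔλ = Δλ if Q′_kλ = 0» (`r_fix`) and «R … is an
orthogonal projection on the linear subspace ΔN(Q′_k)» — every Rω is a Δλ with Q′_kλ = 0 (`r_range`), (1.71)
«Δ_a⁻¹ = G» (`g_da`, `da_g`). [cite: Balaban1984PropagatorsI, (1.69) p.29, (1.55) p.27, p.25, (1.71) p.30] -/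
structure Ops.Laws (X : Ops S V S₁ W) : Prop where
  da_eq : X.Da = X.K + X.D * X.R * X.Ds + X.a • (X.Qs * X.Q)
  curl_grad : X.K * X.D = 0
  div_grad : X.Ds * X.D = X.Lap
  q_grad : X.Q * X.D = X.D₁ * X.Q'
  r_fix : ∀ l : S → ℂ, X.Q' *ᵥ l = 0 → X.R *ᵥ (X.Lap *ᵥ l) = X.Lap *ᵥ l
  r_range : ∀ w : S → ℂ, ∃ l : S → ℂ, X.Q' *ᵥ l = 0 ∧ X.R *ᵥ w = X.Lap *ᵥ l
  g_da : X.G * X.Da = 1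
  da_g : X.Da * X.G = 1

/-- The adjointness facts used for the LEFT halves of (1.95)/(1.97): Prop. 1.1 «The operator G is a symmetric
operator on L²(T_η)» (`g_herm`), p. 25 «R … is an orthogonal projection» (`r_herm`), ∂* = the adjoint of ∂ for
the η^d-weighted products of (1.21) on both scalar and vector functions (`ds_eq`), and Q* = the adjoint of Q_k
between the η^d-weighted product on T_η and the unit-lattice product — on matrices a REAL multiple `c` of the
conjugate transpose (`qs_eq`; in the tree `c = n^d`, `B5DeltaA169.QvAdj`). [cite: Balaban1984PropagatorsI, Prop. 1.1 p.33, p.25, (1.21) p.21, (1.74) p.30] -/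
structure Ops.Adj (X : Ops S V S₁ W) : Prop where
  g_herm : X.Gᴴ = X.G
  r_herm : X.Rᴴ = X.R
  ds_eq : X.Ds = X.Dᴴ
  qs_eq : ∃ c : ℝ, X.Qs = (c : ℂ) • X.Qᴴ

/-! ## §1  The mechanism: Δ_a maps pure gauges of N(Q′_k) to gradients of Laplacians -/

/-- two matrices agreeing on every vector are equal (private Mathlib-level plumbing for the operator identities
(1.95)/(1.97) of Bałaban, CMP 95; not a statement of the paper). [folklore] -/
private theorem ext_of_mulVec {m n : Type*} [Fintype n] [DecidableEq n] {A B : Matrix m n ℂ}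
    (h : ∀ v : n → ℂ, A *ᵥ v = B *ᵥ v) : A = B := by
  apply Matrix.toLin'.injective
  apply LinearMap.ext
  intro v
  simpa [Matrix.toLin'_apply] using h v

variable {X : Ops S V S₁ W}

/-- **Δ_a(∂λ) = ∂(Δλ) for λ ∈ N(Q′_k)** — from (1.69): ∂*∂(∂λ) = 0, ∂R∂*∂λ = ∂RΔλ = ∂Δλ (p. 25), aQ*Q∂λ =
aQ*∂₁Q′_kλ = 0 ((1.55)).  This is the step behind «Calculating ∂*G∂ …» (1.96) ⇒ (1.97).
[cite: Balaban1984PropagatorsI, (1.69) p.29, (1.55) p.27, p.25, (1.96)–(1.97) pp.33–34] -/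
theorem da_grad (hX : X.Laws) (l : S → ℂ) (hl : X.Q' *ᵥ l = 0) :
    X.Da *ᵥ (X.D *ᵥ l) = X.D *ᵥ (X.Lap *ᵥ l) := by
  have h2 : X.Da * X.D = X.D * X.R * X.Lap + X.a • (X.Qs * (X.D₁ * X.Q')) := by
    rw [hX.da_eq, Matrix.add_mul, Matrix.add_mul, hX.curl_grad, zero_add, Matrix.mul_assoc,
      Matrix.mul_assoc, hX.div_grad, Matrix.smul_mul, Matrix.mul_assoc, hX.q_grad, ← Matrix.mul_assoc]
  calc X.Da *ᵥ (X.D *ᵥ l) = (X.Da * X.D) *ᵥ l := by rw [Matrix.mulVec_mulVec]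
    _ = (X.D * X.R * X.Lap) *ᵥ l + (X.a • (X.Qs * (X.D₁ * X.Q'))) *ᵥ l := by
        rw [h2, Matrix.add_mulVec]
    _ = X.D *ᵥ (X.R *ᵥ (X.Lap *ᵥ l)) + X.a • (X.Qs *ᵥ (X.D₁ *ᵥ (X.Q' *ᵥ l))) := by
        rw [Matrix.smul_mulVec, ← Matrix.mulVec_mulVec, ← Matrix.mulVec_mulVec, ← Matrix.mulVec_mulVec,
          ← Matrix.mulVec_mulVec]
    _ = X.D *ᵥ (X.Lap *ᵥ l) := by
        rw [hl, Matrix.mulVec_zero, Matrix.mulVec_zero, smul_zero, add_zero, hX.r_fix l hl]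

/-- **G∂Rω = ∂λ** where Rω = Δλ, Q′_kλ = 0 (apply G = Δ_a⁻¹ to `da_grad`).
[cite: Balaban1984PropagatorsI, (1.71) p.30, (1.97) p.34] -/
theorem g_grad_r (hX : X.Laws) (w : S → ℂ) :
    ∃ l : S → ℂ, X.Q' *ᵥ l = 0 ∧ X.R *ᵥ w = X.Lap *ᵥ l ∧ X.G *ᵥ (X.D *ᵥ (X.R *ᵥ w)) = X.D *ᵥ l := by
  obtain ⟨l, hl, hw⟩ := hX.r_range w
  refine ⟨l, hl, hw, ?_⟩
  rw [hw, ← da_grad hX l hl, Matrix.mulVec_mulVec, hX.g_da, Matrix.one_mulVec]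

/-! ## §2  (1.97) and (1.95), right forms; R is idempotent -/

/-- **(1.97), right form: `∂*G∂R = R`.** [cite: Balaban1984PropagatorsI, (1.97) p.34] -/
theorem eq197_right [DecidableEq S] (hX : X.Laws) : X.Ds * X.G * X.D * X.R = X.R := by
  apply ext_of_mulVec
  intro w
  obtain ⟨l, _, hw, hG⟩ := g_grad_r hX w
  rw [← Matrix.mulVec_mulVec, ← Matrix.mulVec_mulVec, ← Matrix.mulVec_mulVec, hG, Matrix.mulVec_mulVec,
    hX.div_grad, hw]

/-- **(1.95), second identity: `QG∂R = 0`** (Q∂λ = ∂₁Q′_kλ = 0 on N(Q′_k)).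
[cite: Balaban1984PropagatorsI, (1.95) p.33] -/
theorem eq195_right [DecidableEq S] (hX : X.Laws) : X.Q * X.G * X.D * X.R = 0 := by
  apply ext_of_mulVec
  intro w
  obtain ⟨l, hl, _, hG⟩ := g_grad_r hX w
  rw [← Matrix.mulVec_mulVec, ← Matrix.mulVec_mulVec, ← Matrix.mulVec_mulVec, hG, Matrix.mulVec_mulVec,
    hX.q_grad, ← Matrix.mulVec_mulVec, hl, Matrix.mulVec_zero, Matrix.zero_mulVec]

/-- «R … is a projection»: `R² = R`, from the two p. 25 sentences. [cite: Balaban1984PropagatorsI, p.25] -/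
theorem r_idem [DecidableEq S] (hX : X.Laws) : X.R * X.R = X.R := by
  apply ext_of_mulVec
  intro w
  obtain ⟨l, hl, hw⟩ := hX.r_range w
  rw [← Matrix.mulVec_mulVec, hw, hX.r_fix l hl]

/-! ## §3  The left forms via adjoints, and the inference (1.98) -/

/-- **(1.97), left form: `R∂*G∂ = R`** — the adjoint of `eq197_right` (G, R symmetric, ∂* = ∂ᴴ).
[cite: Balaban1984PropagatorsI, (1.97) p.34] -/
theorem eq197_left [DecidableEq S] (hX : X.Laws) (hA : X.Adj) : X.R * X.Ds * X.G * X.D = X.R := by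
  have h := congrArg Matrix.conjTranspose (eq197_right hX)
  rw [Matrix.conjTranspose_mul, Matrix.conjTranspose_mul, Matrix.conjTranspose_mul, hA.r_herm, hA.g_herm,
    hA.ds_eq, Matrix.conjTranspose_conjTranspose] at h
  rw [hA.ds_eq]
  simpa only [Matrix.mul_assoc] using h

/-- **(1.95), first identity: `R∂*GQ* = 0`** — the adjoint of `eq195_right` (Q* = c·Qᴴ).
[cite: Balaban1984PropagatorsI, (1.95) p.33] -/
theorem eq195_left [DecidableEq S] (hX : X.Laws) (hA : X.Adj) : X.R * X.Ds * X.G * X.Qs = 0 := by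
  obtain ⟨c, hc⟩ := hA.qs_eq
  have h := congrArg Matrix.conjTranspose (eq195_right hX)
  rw [Matrix.conjTranspose_mul, Matrix.conjTranspose_mul, Matrix.conjTranspose_mul, hA.r_herm, hA.g_herm,
    Matrix.conjTranspose_zero] at h
  have h' : X.R * X.Dᴴ * X.G * X.Qᴴ = 0 := by simpa only [Matrix.mul_assoc] using h
  rw [hA.ds_eq, hc, Matrix.mul_smul, h', smul_zero]

/-- «The equalities (1.95), (1.97) imply that the second equation in (1.93) has the form Rλ = λ = 0» — hence
(1.98) `A = −GQ*ω − G∂λ = −GQ*ω`. [cite: Balaban1984PropagatorsI, (1.93) p.33, (1.98) p.34] -/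
theorem eq198 [DecidableEq S] (hX : X.Laws) (hA : X.Adj) (ω : W → ℂ) (l : S → ℂ) (hRl : X.R *ᵥ l = l)
    (h193 : X.R *ᵥ (X.Ds *ᵥ (X.G *ᵥ (X.Qs *ᵥ ω))) + X.R *ᵥ (X.Ds *ᵥ (X.G *ᵥ (X.D *ᵥ l))) = 0) :
    l = 0 ∧ -(X.G *ᵥ (X.Qs *ᵥ ω)) - X.G *ᵥ (X.D *ᵥ l) = -(X.G *ᵥ (X.Qs *ᵥ ω)) := by
  have h1 : X.R *ᵥ (X.Ds *ᵥ (X.G *ᵥ (X.Qs *ᵥ ω))) = 0 := by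
    rw [Matrix.mulVec_mulVec, Matrix.mulVec_mulVec, Matrix.mulVec_mulVec, eq195_left hX hA,
      Matrix.zero_mulVec]
  have h2 : X.R *ᵥ (X.Ds *ᵥ (X.G *ᵥ (X.D *ᵥ l))) = l := by
    rw [Matrix.mulVec_mulVec, Matrix.mulVec_mulVec, Matrix.mulVec_mulVec, eq197_left hX hA, hRl]
  rw [h1, h2, zero_add] at h193
  refine ⟨h193, ?_⟩
  rw [h193, Matrix.mulVec_zero, Matrix.mulVec_zero, sub_zero]

/-! ## §4  The projection (1.106)/(1.107) -/

/-- **(1.107)** `P = I − G∂R∂* − GQ*(QGQ*)⁻¹Q`, with `E` standing for `(QGQ*)⁻¹` ((1.100): QGQ* is bounded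
below by a positive operator, hence invertible; `E` is constrained by `X.Q * X.G * X.Qs * E = 1` in the theorems).
[cite: Balaban1984PropagatorsI, (1.107) p.35] -/
def proj107 (X : Ops S V S₁ W) (E : Matrix W W ℂ) : Matrix V V ℂ :=
  1 - X.G * X.D * X.R * X.Ds - X.G * X.Qs * E * X.Q

/-- «The second equation gives QA₀ = QA − QG∂R∂*A − QGQ*ω = QA − QGQ*ω = 0»: **`QP = 0`**.
[cite: Balaban1984PropagatorsI, (1.106) p.35] -/
theorem q_proj107 [DecidableEq S] [DecidableEq W] (hX : X.Laws) (E : Matrix W W ℂ)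
    (hE : X.Q * X.G * X.Qs * E = 1) : X.Q * proj107 X E = 0 := by
  have h95 := eq195_right hX
  rw [proj107, Matrix.mul_sub, Matrix.mul_sub, Matrix.mul_one]
  have h1 : X.Q * (X.G * X.D * X.R * X.Ds) = (X.Q * X.G * X.D * X.R) * X.Ds := by
    simp only [Matrix.mul_assoc]
  have h2 : X.Q * (X.G * X.Qs * E * X.Q) = (X.Q * X.G * X.Qs * E) * X.Q := by
    simp only [Matrix.mul_assoc]
  rw [h1, h2, h95, hE, Matrix.zero_mul, Matrix.one_mul, sub_zero, sub_self]

/-- «R∂*A₀ = R∂*A − R∂*GQ*ω − R∂*G∂λ = R∂*A − λ = 0»: **`R∂*P = 0`**. [cite: Balaban1984PropagatorsI, (1.106) p.35] -/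
theorem rds_proj107 [DecidableEq S] (hX : X.Laws) (hA : X.Adj) (E : Matrix W W ℂ) :
    X.R * X.Ds * proj107 X E = 0 := by
  have h97 := eq197_left hX hA
  have h95 := eq195_left hX hA
  have hRR := r_idem hX
  rw [proj107, Matrix.mul_sub, Matrix.mul_sub, Matrix.mul_one]
  have h1 : X.R * X.Ds * (X.G * X.D * X.R * X.Ds) = (X.R * X.Ds * X.G * X.D) * X.R * X.Ds := by
    simp only [Matrix.mul_assoc]
  have h2 : X.R * X.Ds * (X.G * X.Qs * E * X.Q) = (X.R * X.Ds * X.G * X.Qs) * E * X.Q := by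
    simp only [Matrix.mul_assoc]
  rw [h1, h2, h97, h95, hRR, Matrix.zero_mul, Matrix.zero_mul, sub_zero, sub_self]

omit [Fintype S₁] in
/-- `P` is the identity on the subspace {QA = 0, R∂*A = 0}. [cite: Balaban1984PropagatorsI, (1.106) p.35] -/
theorem proj107_fix (E : Matrix W W ℂ) (A : V → ℂ) (hQ : X.Q *ᵥ A = 0) (hR : X.R *ᵥ (X.Ds *ᵥ A) = 0) :
    proj107 X E *ᵥ A = A := by
  rw [proj107, Matrix.sub_mulVec, Matrix.sub_mulVec, Matrix.one_mulVec, ← Matrix.mulVec_mulVec,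
    ← Matrix.mulVec_mulVec, ← Matrix.mulVec_mulVec, hR, ← Matrix.mulVec_mulVec, ← Matrix.mulVec_mulVec,
    ← Matrix.mulVec_mulVec, hQ]
  simp

/-- **`P² = P`** («projection»). [cite: Balaban1984PropagatorsI, (1.107) p.35] -/
theorem proj107_idem [DecidableEq S] [DecidableEq W] (hX : X.Laws) (hA : X.Adj) (E : Matrix W W ℂ)
    (hE : X.Q * X.G * X.Qs * E = 1) : proj107 X E * proj107 X E = proj107 X E := by
  have hq := q_proj107 hX E hE
  have hr := rds_proj107 hX hA E
  have h : proj107 X E * proj107 X E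
      = proj107 X E - X.G * X.D * (X.R * X.Ds * proj107 X E) - X.G * X.Qs * E * (X.Q * proj107 X E) := by
    nth_rw 1 [proj107]
    simp only [Matrix.sub_mul, Matrix.one_mul, Matrix.mul_assoc]
  rw [h, hq, hr, Matrix.mul_zero, Matrix.mul_zero, sub_zero, sub_zero]

omit [Fintype S₁] in
/-- the decomposition behind (1.106): `A − PA = G∂R∂*A + GQ*EQA`. [cite: Balaban1984PropagatorsI, (1.106) p.35] -/
theorem sub_proj107_mulVec (E : Matrix W W ℂ) (A : V → ℂ) :
    A - proj107 X E *ᵥ A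
      = X.G *ᵥ (X.D *ᵥ (X.R *ᵥ (X.Ds *ᵥ A))) + X.G *ᵥ (X.Qs *ᵥ (E *ᵥ (X.Q *ᵥ A))) := by
  rw [proj107, Matrix.sub_mulVec, Matrix.sub_mulVec, Matrix.one_mulVec]
  simp only [← Matrix.mulVec_mulVec]
  abel

/-- `Δ_a(A − PA) = ∂R∂*A + Q*EQA` (G = Δ_a⁻¹). [cite: Balaban1984PropagatorsI, (1.105)–(1.106) pp.34–35] -/
theorem da_sub_proj107_mulVec (hX : X.Laws) (E : Matrix W W ℂ) (A : V → ℂ) :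
    X.Da *ᵥ (A - proj107 X E *ᵥ A) = X.D *ᵥ (X.R *ᵥ (X.Ds *ᵥ A)) + X.Qs *ᵥ (E *ᵥ (X.Q *ᵥ A)) := by
  rw [sub_proj107_mulVec, Matrix.mulVec_add, Matrix.mulVec_mulVec _ X.Da X.G, Matrix.mulVec_mulVec _ X.Da X.G,
    hX.da_g, Matrix.one_mulVec, Matrix.one_mulVec]

/-- **Δ_a-orthogonality** («an orthogonal projection in the metric ⟨A, Δ_aA⟩ on the subspace of A satisfying
the conditions QA = 0, R∂*A = 0»): for A₀ in that subspace and any A, ⟨A₀, Δ_a(A − PA)⟩ = 0, where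
⟨u, v⟩ = Σ conj(u)·v. [cite: Balaban1984PropagatorsI, p.34 (before (1.104)), (1.106) p.35] -/
theorem proj107_orth (hX : X.Laws) (hA : X.Adj) (E : Matrix W W ℂ) (A A₀ : V → ℂ)
    (hQ : X.Q *ᵥ A₀ = 0) (hR : X.R *ᵥ (X.Ds *ᵥ A₀) = 0) :
    star A₀ ⬝ᵥ (X.Da *ᵥ (A - proj107 X E *ᵥ A)) = 0 := by
  obtain ⟨c, hc⟩ := hA.qs_eq
  rw [da_sub_proj107_mulVec hX, dotProduct_add]
  -- first term: ⟨A₀, ∂R∂*A⟩ = ⟨R∂*A₀, ∂*A⟩ = 0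
  have e0 : star (X.R *ᵥ (X.Ds *ᵥ A₀)) = star A₀ ᵥ* (X.D * X.R) := by
    rw [Matrix.star_mulVec, Matrix.star_mulVec, Matrix.vecMul_vecMul, hA.ds_eq,
      Matrix.conjTranspose_conjTranspose, hA.r_herm]
  have h1 : star A₀ ⬝ᵥ (X.D *ᵥ (X.R *ᵥ (X.Ds *ᵥ A))) = 0 := by
    calc star A₀ ⬝ᵥ (X.D *ᵥ (X.R *ᵥ (X.Ds *ᵥ A)))
        = (star A₀ ᵥ* (X.D * X.R)) ⬝ᵥ (X.Ds *ᵥ A) := by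
          rw [Matrix.dotProduct_mulVec, Matrix.dotProduct_mulVec, Matrix.vecMul_vecMul]
      _ = star (X.R *ᵥ (X.Ds *ᵥ A₀)) ⬝ᵥ (X.Ds *ᵥ A) := by rw [e0]
      _ = 0 := by rw [hR, star_zero, zero_dotProduct]
  -- second term: ⟨A₀, Q*w⟩ = c⟨QA₀, w⟩ = 0
  have h2 : star A₀ ⬝ᵥ (X.Qs *ᵥ (E *ᵥ (X.Q *ᵥ A))) = 0 := by
    rw [hc, Matrix.smul_mulVec, dotProduct_smul, Matrix.dotProduct_mulVec, ← Matrix.star_mulVec, hQ,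
      star_zero, zero_dotProduct, smul_zero]
  rw [h1, h2, add_zero]

/-- **(1.106) solves (1.105)**: with ω := (QGQ*)⁻¹QA and λ := R∂*A, A₀ := PA satisfies
Δ_aA₀ − Δ_aA + Q*ω + ∂λ = 0, QA₀ = 0, R∂*A₀ = 0. [cite: Balaban1984PropagatorsI, (1.105)–(1.106) pp.34–35] -/
theorem proj107_solves_105 [DecidableEq S] [DecidableEq W] (hX : X.Laws) (hA : X.Adj) (E : Matrix W W ℂ)
    (hE : X.Q * X.G * X.Qs * E = 1) (A : V → ℂ) :
    X.Da *ᵥ (proj107 X E *ᵥ A) - X.Da *ᵥ A + X.Qs *ᵥ (E *ᵥ (X.Q *ᵥ A)) + X.D *ᵥ (X.R *ᵥ (X.Ds *ᵥ A)) = 0 ∧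
      X.Q *ᵥ (proj107 X E *ᵥ A) = 0 ∧ X.R *ᵥ (X.Ds *ᵥ (proj107 X E *ᵥ A)) = 0 := by
  refine ⟨?_, ?_, ?_⟩
  · have h := da_sub_proj107_mulVec hX E A
    rw [Matrix.mulVec_sub] at h
    have h' : X.Da *ᵥ (proj107 X E *ᵥ A) - X.Da *ᵥ A
        = -(X.D *ᵥ (X.R *ᵥ (X.Ds *ᵥ A)) + X.Qs *ᵥ (E *ᵥ (X.Q *ᵥ A))) := by
      rw [← h]; abel
    rw [h']; abel
  · rw [Matrix.mulVec_mulVec, q_proj107 hX E hE, Matrix.zero_mulVec]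
  · rw [Matrix.mulVec_mulVec, Matrix.mulVec_mulVec, Matrix.mul_assoc, ← Matrix.mul_assoc X.R,
      rds_proj107 hX hA E, Matrix.zero_mulVec]

end Literature.MathematicalPhysics.QuantumFieldTheory.Balaban1983to89.B5Identities197
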